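import Literature.MathematicalPhysics.QuantumFieldTheory.Balaban1983to89.T3PrintedRegularMinimiserReduction
import Literature.MathematicalPhysics.QuantumFieldTheory.Balaban1983to89.T3ThresholdSmallness
import HarnessLib

/-!
# `Balaban1983to89.T3PrintedMinimiserExistence` — rung R3, crux K1, child «MinimiserStabilityRegPr», stub EXIST: what
# [Balaban1985Variational] Thm 1 + Prop 7 give for `HasRegMinimisersPrAt`, AS PRINTED vs AS NEEDED — the minimum over the space (6)
# is the GLOBAL reading of «minimal»; the located gap «inf over (6) = min over (8)» as a schema; the threshold bookkeeping PROVED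

Cell `ym3-torus` (HUMAN RULING D-0037, YM ladder rung R3), seat `ym3-torus-p1` gen 6 (UV side); cell record HOME/UV3-NODE.md §13.  WHAT
THIS IS NOT: no estimate of the series and NOT a proof of the stub `T3PrintedRegularMinimiserReduction.HasRegMinimisersPrAt` — the analytic
content is ONE hypothesis schema in the family's vocabulary (`Thm1GlobalMinAt`, never asserted); what is PROVED is (i) the exact implication
schema ⇒ stub under the route's quantifier prefix, with every «`B₃θ ≤ ε₀`, `θ ≤ a₁`, `ε₀ ≤ a₀`» step discharged by the threshold arithmetic
of `T3ThresholdSmallness`, and (ii) the decomposition of the schema into Thm 1's existence clause verbatim and ONE located statement.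

THE POINT (finding F-g6-1 of the cell memo).  The stub `HasRegMinimisersPrAt F γ b₀ p₀ m ε₀` asks, from some `K₀` on, that the Wilson action
ATTAIN ITS INFIMUM over print's space (6) = `regFibrePr F ⌊K/m⌋ K _ ε₀ V` (both clauses of [Balaban1985Variational] (2) at the FIXED radius
`ε₀`, ∩ the (0.4)-averaging fibre of `V`) for run `K` and run `K+1`, for every datum `V` with plaquettes within `θBal(⌊K/m⌋)` of `1`.  Print:
* Thm 1 p. 279: for `V` satisfying (7) with `ε₁ ≤ a₁` «there exists a minimal orbit in the space 𝔘_k({Ω_j}, B₃ε₁) ∩ 𝔅_k(𝔅_k, V) (8).  This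
  orbit is a unique critical orbit in the space (6) if B₃ε₁ ≤ ε₀ and ε₀ ≤ a₀»; Prop 7 p. 299: «for ε₀ ≤ a₀ and B₃ε₁ ≤ ε₀ the variational
  problem (5), (6) has at most one critical orbit.  If ε₁ ≤ a₁, then there exists a minimal orbit in the space (6) with ε₀ = O(1)C₁B₃ε₁»;
  p. 281 l. 19–21 «there exists exactly one critical configuration, which is a minimum of the functional (5)»; the minimum property is ARGUED
  on p. 299 l. 31–34: «A second order differential at A′ = 0 is given by the quadratic form above, and it is positive definite.  Hence A′ = 0 is a
  minimum of the functional (143) and this implies that U_k is a minimal configuration of the functional A(U)» — a LOCAL statement.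
* So, AS PRINTED (global-in-(8) reading of «minimal orbit in the space (8)», the reading of the LQB lane's dictionary
  `B10NestedMinimizer.B11Dict` (ii)): the action attains its minimum over the SMALL space (8) = `regFibrePr … (B₃ε₁) V` at `U_k(V)`, and
  `U_k(V)` is the unique critical orbit in the BIG space (6) = `regFibrePr … ε₀ V`.  AS NEEDED by the stub: the minimum over the BIG space
  (6) at FIXED `ε₀` while `ε₁ = θBal(⌊K/m⌋) → 0`.  The upgrade «unique critical orbit in (6) + local minimum ⇒ minimum over (6)» needs
  ATTAINMENT of the infimum of (5) over the open space (6) at an interior point — the LQB lane recorded exactly this as the unprinted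
  hypothesis `hattain` of `B10NestedMinimizer.isMinOn_of_exists_min_of_unique_crit` (cell DIVERGENCE D-B11-2: local vs global reading of
  «minimal»), «no consumer needing it» THERE; the d = 3 route's K1 line IS such a consumer.  Located gap **G-K1aR-2** := `InfSixOfEightAt`
  below.  PRINTED IN KIND: the expansion (142) p. 299 `𝒢(A′) = A(U_k) + ½⟨A′, Δ₁A′⟩ + V(A′)` with `Δ₁` positive definite ([Balaban1985BackgroundPropagators])
  and Sect. C's bounds on `V(A′)` over the WHOLE chart (19)–(21) ⊇ (6) give `𝒢(A′) > A(U_k)` for `A′ ≠ 0` in the chart, i.e. the global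
  minimum over (6); print draws only the local conclusion.
* PORT (finding F-g6-2): the constraint (3) of [Balaban1985Variational] is the averaging of [Balaban1985Averaging] (15) (= [Balaban1987RG1]
  (0.12)); the family's `blockAvg ℰp` is [Balaban1987RG1] (0.4) (tree `BlockAveraging`, `BlockAveragingExpMeanLog`), covered in print by the
  universality assertion [Balaban1987RG1] p. 253 «The considerations and results of this, and previous papers, do not depend on any particular
  averaging operation used; they are valid universally for all averages satisfying the above properties» ([Balaban1985Averaging] p. 20 «can be
  easily extended to other definitions of averaging operations») — asserted, not re-proved; and the family's total averaging equals (0.4) only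
  on the guard `Small` (all (0.4) loop variables within `δ` of `1`), inside which every printed-regular configuration lies once
  `c(L)·ε₀ < δ` by a non-abelian Stokes bound (cell gap G-K1a-5).

CONTENTS.
* §1 monotonicity of the regular spaces in the radius (`plaqSmall_of_le`, `divSmall_mono`, `regPr_mono`, `regFibre_mono`, `regFibrePr_mono`:
  (8) ⊆ (6) for `B₃ε₁ ≤ ε₀`) and `minActionRegPr_eq_of_isMinOn` (a minimiser realises the `sInf`).
* §2 **`Thm1GlobalMinAt L a₀ a₁ B₃`** / `Thm1GlobalMin L` — Thm 1 + Prop 7 in the GLOBAL reading for the family's (0.4)-fibres, pure small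
  field (every `Ω_j` the torus), `d = 3`, `G = SU(2)`: for `0 < ε₁ ≤ a₁`, `B₃ε₁ ≤ ε₀ ≤ a₀`, `n < K`, every `V` with `PlaqSmall ε₁ V` has a
  configuration in (8) minimising the Wilson action over (6) (hypothesis schema, never asserted).
* §3 **`hasRegMinimisersPrAt_of_thm1GlobalMin`** (PROVED): `Thm1GlobalMin L` ⇒ `∀ ε₀ ∈ (0, a₀], ∀ m ≥ 2, ∀ b₀ > 0, ∀ p₀, ∃ γ₁ > 0,
  ∀ F γ, F.L = L → 0 < γ ≤ γ₁ → HasRegMinimisersPrAt F γ b₀ p₀ m ε₀` with `K₀ = 1` — the EXIST stub's prefix of the route (`ε₀` before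
  `γ₁`; `T3ThresholdSmallness.exists_forall_θBal_le` supplies `θBal ≤ min a₁ (ε₀/B₃)` at every height; `m ≥ 2` makes `⌊K/m⌋ < K`).
* §4 **`Thm1MinimalIn8At L a₁ B₃`** — Thm 1's existence clause verbatim-shaped (minimum over (8)); **`InfSixOfEightAt L a₀ a₁ B₃`** — G-K1aR-2 as
  a schema (a minimiser over (8) minimises over (6)); `thm1GlobalMinAt_of_minimalIn8` / `thm1MinimalIn8At_of_globalMin` (PROVED bookkeeping:
  `Thm1GlobalMinAt ↔ Thm1MinimalIn8At ∧ InfSixOfEightAt` up to the shared constants).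

References: T. Bałaban, «The variational problem and background fields in renormalization group method for lattice gauge theories», Commun.
Math. Phys. 102 (1985) 277–309 [Balaban1985Variational] ((2)–(8) p.278–279, Thm 1 p.279, p.281 l.19–21, (142) and Prop 7 p.299, Prop 8
p.304); «Averaging operations for lattice gauge theories», CMP 98 (1985) 17–51 [Balaban1985Averaging] ((15) p.19, p.20); «Renormalization
group approach to lattice gauge field theories. I», CMP 109 (1987) 249–301 [Balaban1987RG1] ((0.4), p.253–254); «Ultraviolet stability of
three-dimensional lattice pure gauge field theories», CMP 102 (1985) 255–275 [Balaban1985UV3] ((7) p.257, (41)–(42) p.266).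
-/

noncomputable section

open MeasureTheory Filter Topology
open Literature.MathematicalPhysics.QuantumFieldTheory.Balaban1983to89.T3ContinuumYM3Torus
open Literature.MathematicalPhysics.QuantumFieldTheory.Balaban1983to89.T3UnitLawDensityEML (ℰp measurableE_ℰp)
open Literature.MathematicalPhysics.QuantumFieldTheory.Balaban1983to89.T3UnitScaleTilt
open Literature.MathematicalPhysics.QuantumFieldTheory.Balaban1983to89.T3ConstrainedMinimiser
open Literature.MathematicalPhysics.QuantumFieldTheory.Balaban1983to89.T3MinimiserStabilityReduction
open Literature.MathematicalPhysics.QuantumFieldTheory.Balaban1983to89.T3RegularMinimiser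
open Literature.MathematicalPhysics.QuantumFieldTheory.Balaban1983to89.T3PrintedRegularMinimiser
open Literature.MathematicalPhysics.QuantumFieldTheory.Balaban1983to89.T3PrintedRegularMinimiserReduction
open Literature.MathematicalPhysics.QuantumFieldTheory.Balaban1983to89.T3ThresholdSmallness (exists_forall_θBal_le)
open Literature.MathematicalPhysics.QuantumFieldTheory.Balaban1983to89.B10Eq27TorusAxialLog (toUField unitsField)
open Literature.MathematicalPhysics.QuantumFieldTheory.Balaban1983to89.B10Eq68TorusRegularity (covDivT)
open Literature.MathematicalPhysics.QuantumFieldTheory.Balaban1983to89.Missing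

namespace Literature.MathematicalPhysics.QuantumFieldTheory.Balaban1983to89.T3PrintedMinimiserExistence

/-! ## §1 Monotonicity of the regular spaces in the radius: (8) ⊆ (6) for `B₃ε₁ ≤ ε₀`; a minimiser realises the infimum -/

section Mono

variable (F : T3Family) {n K : ℕ} {h : n ≤ K} {ε ε' : ℝ}

/-- `PlaqSmall δ ⇒ PlaqSmall δ'` for `δ ≤ δ'`. [cite: Balaban1987RG1, (0.18) p.255] -/
theorem plaqSmall_of_le {P : Params} {j : ℕ} {G : Type*} [GaugeGroup G] {δ δ' : ℝ} (hδ : δ ≤ δ') {U : GaugeField P j G}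
    (hU : PlaqSmall δ U) : PlaqSmall δ' U :=
  fun p => (hU p).trans_le hδ

/-- The divergence clause is monotone in the radius: `DivSmall ε ⇒ DivSmall ε'` for `ε ≤ ε'`. [cite: Balaban1985RegularSpaces, (1.9) p.77] -/
theorem divSmall_mono (hε : ε ≤ ε') {U : GaugeField (F.P K) 0 (Matrix.specialUnitaryGroup (Fin 2) ℂ)} (hU : DivSmall F n K ε U) :
    DivSmall F n K ε' U := fun b =>
  (hU b).trans_le (mul_le_mul_of_nonneg_right hε (pow_nonneg (inv_nonneg.mpr (Nat.cast_nonneg _)) _))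

/-- The regularity threshold is monotone in the radius. [cite: Balaban1985Variational, (2) p.278] -/
theorem regThreshold_mono (hε : ε ≤ ε') : regThreshold F n K ε ≤ regThreshold F n K ε' :=
  mul_le_mul_of_nonneg_right hε (pow_nonneg (inv_nonneg.mpr (Nat.cast_nonneg _)) _)

/-- `𝔘_k(ε) ⊆ 𝔘_k(ε')` for `ε ≤ ε'` (both clauses). [cite: Balaban1985Variational, (2) p.278] -/
theorem regPr_mono (hε : ε ≤ ε') {U : GaugeField (F.P K) 0 (Matrix.specialUnitaryGroup (Fin 2) ℂ)} (hU : RegPr F n K ε U) :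
    RegPr F n K ε' U :=
  ⟨plaqSmall_of_le (regThreshold_mono F hε) hU.1, divSmall_mono F hε hU.2⟩

/-- The plaquette-only regular fibre is monotone in the radius. [cite: Balaban1985Variational, (6) p.278] -/
theorem regFibre_mono (hε : ε ≤ ε') (V : GaugeField (F.P n) 0 (Matrix.specialUnitaryGroup (Fin 2) ℂ)) :
    regFibre F ℰp n K h ε V ⊆ regFibre F ℰp n K h ε' V :=
  fun _ hU => ⟨hU.1, plaqSmall_of_le (regThreshold_mono F hε) hU.2⟩

/-- **(8) ⊆ (6)**: print's regular fibre is monotone in the radius (`𝔘_k(B₃ε₁) ∩ 𝔅_k(V) ⊆ 𝔘_k(ε₀) ∩ 𝔅_k(V)` for `B₃ε₁ ≤ ε₀`).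
[cite: Balaban1985Variational, (6) and (8) p.278–279] -/
theorem regFibrePr_mono (hε : ε ≤ ε') (V : GaugeField (F.P n) 0 (Matrix.specialUnitaryGroup (Fin 2) ℂ)) :
    regFibrePr F n K h ε V ⊆ regFibrePr F n K h ε' V :=
  fun _ hU => ⟨regFibre_mono F hε V hU.1, divSmall_mono F hε hU.2⟩

/-- A minimiser of the Wilson action over print's regular fibre REALISES `minActionRegPr` (the `sInf`). [cite: Balaban1985Variational, Thm 1 (8) p.279] -/
theorem minActionRegPr_eq_of_isMinOn {V : GaugeField (F.P n) 0 (Matrix.specialUnitaryGroup (Fin 2) ℂ)}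
    {U : GaugeField (F.P K) 0 (Matrix.specialUnitaryGroup (Fin 2) ℂ)} (hU : U ∈ regFibrePr F n K h ε V)
    (hmin : IsMinOn (fun W : GaugeField (F.P K) 0 (Matrix.specialUnitaryGroup (Fin 2) ℂ) => wilsonAction4 W) (regFibrePr F n K h ε V) U) :
    wilsonAction4 U = minActionRegPr F n K h ε V := by
  refine le_antisymm ?_ (minActionRegPr_le F hU)
  exact le_csInf ⟨_, U, hU, rfl⟩ (by rintro _ ⟨W, hW, rfl⟩; exact hmin hW)

end Mono

/-! ## §2 [7] Thm 1 + Prop 7 in the GLOBAL reading, for the family's (0.4)-fibres (hypothesis schema, never asserted) -/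

section Schema

/-- **[Balaban1985Variational] THM 1 + PROP 7, GLOBAL READING, AT GIVEN CONSTANTS** (hypothesis schema, never asserted): for every member `F`
of the d = 3 family with block size `L` (`G = SU(2)`, pure small field: every `Ω_j` the torus), every pair of levels `n < K` (`k = K − n ≥ 1`
averaging steps), every `0 < ε₁ ≤ a₁` and `B₃ε₁ ≤ ε₀ ≤ a₀`, and every datum `V` on the `n`-th approximation's finest lattice with
`|V(∂p) − 1| < ε₁` (hypothesis (7)), there is a configuration `U` in the space (8) = `regFibrePr F n K _ (B₃ε₁) V` which MINIMISES the Wilson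
action (5) over the space (6) = `regFibrePr F n K _ ε₀ V`.  Print: Thm 1 p. 279 (minimal orbit in (8), unique critical orbit in (6)) and
Prop 7 p. 299 / p. 281 l. 19–21 («which is a minimum of the functional (5)», argued locally: positive second differential, p. 299
l. 31–34); the GLOBAL minimum over (6) at fixed `ε₀` is the reading recorded as cell DIVERGENCE D-B11-2 / located gap G-K1aR-2
(`InfSixOfEightAt` below).  Constants `a₀, a₁, B₃` «depend on d and L only».  PORT: print's constraint (3) is the averaging (15) of
[Balaban1985Averaging]; the family's is (0.4) of [Balaban1987RG1], universality asserted there (p. 253). [cite: Balaban1985Variational, Thm 1 p.279 and Prop 7 p.299] -/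
def Thm1GlobalMinAt (L : ℕ) (a₀ a₁ B₃ : ℝ) : Prop :=
  ∀ F : T3Family, F.L = L → ∀ (n K : ℕ) (hnK : n < K) (ε₁ ε₀ : ℝ), 0 < ε₁ → ε₁ ≤ a₁ → B₃ * ε₁ ≤ ε₀ → ε₀ ≤ a₀ →
    ∀ V : GaugeField (F.P n) 0 (Matrix.specialUnitaryGroup (Fin 2) ℂ), PlaqSmall ε₁ V →
      ∃ U ∈ regFibrePr F n K hnK.le (B₃ * ε₁) V,
        IsMinOn (fun W : GaugeField (F.P K) 0 (Matrix.specialUnitaryGroup (Fin 2) ℂ) => wilsonAction4 W) (regFibrePr F n K hnK.le ε₀ V) U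

/-- **[Balaban1985Variational] THM 1 + PROP 7, GLOBAL READING** with the printed quantifier order: «there exist positive constants
`a₀, a₁, B₃`, `B₃a₁ ≤ a₀`» depending on `d = 3` and `L` only, then `Thm1GlobalMinAt L a₀ a₁ B₃` (hypothesis schema, never asserted).
[cite: Balaban1985Variational, Thm 1 p.279 and Prop 7 p.299] -/
def Thm1GlobalMin (L : ℕ) : Prop :=
  ∃ a₀ a₁ B₃ : ℝ, 0 < a₀ ∧ 0 < a₁ ∧ 0 < B₃ ∧ B₃ * a₁ ≤ a₀ ∧ Thm1GlobalMinAt L a₀ a₁ B₃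

end Schema

/-! ## §3 The EXIST stub from the schema, under the route's prefix (`ε₀` first, then `γ₁(ε₀, b₀, p₀)`; `K₀ = 1`) -/

section Bridge

/-- One level: from `Thm1GlobalMinAt` at radius `ε₁ := θBal(n)` with `θBal(n) ≤ a₁`, `B₃θBal(n) ≤ ε₀ ≤ a₀`, the minimum of the Wilson action
over `regFibrePr F n K _ ε₀ V` is attained, for every `θBal(n)`-small `V` and `n < K`. [cite: Balaban1985Variational, Thm 1 p.279 and Prop 7 p.299] -/
theorem exists_minimiser_of_thm1GlobalMinAt {L : ℕ} {a₀ a₁ B₃ : ℝ} (hT : Thm1GlobalMinAt L a₀ a₁ B₃) {F : T3Family} (hF : F.L = L)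
    {n K : ℕ} (hnK : n < K) {ε₁ ε₀ : ℝ} (hε₁ : 0 < ε₁) (hε₁a : ε₁ ≤ a₁) (hlo : B₃ * ε₁ ≤ ε₀) (hhi : ε₀ ≤ a₀)
    {V : GaugeField (F.P n) 0 (Matrix.specialUnitaryGroup (Fin 2) ℂ)} (hV : PlaqSmall ε₁ V) :
    ∃ U ∈ regFibrePr F n K hnK.le ε₀ V, wilsonAction4 U = minActionRegPr F n K hnK.le ε₀ V := by
  obtain ⟨U, hU8, hmin⟩ := hT F hF n K hnK ε₁ ε₀ hε₁ hε₁a hlo hhi V hV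
  have hU6 : U ∈ regFibrePr F n K hnK.le ε₀ V := regFibrePr_mono F hlo V hU8
  exact ⟨U, hU6, minActionRegPr_eq_of_isMinOn F hU6 hmin⟩

/-- **THE EXIST STUB ⇐ THE SCHEMA, UNDER THE ROUTE'S PREFIX.**  If [Balaban1985Variational] Thm 1 + Prop 7 hold in the global reading for the
family's fibres at block size `L` (`Thm1GlobalMin L`), then there is `ε₁' > 0` (namely `a₀`) such that for every `0 < ε₀ ≤ ε₁'`, every
`m ≥ 2`, every `b₀ > 0` and every real `p₀` there is `γ₁ > 0` with `HasRegMinimisersPrAt F γ b₀ p₀ m ε₀` for all `F` with `F.L = L` and all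
`0 < γ ≤ γ₁` — with `K₀ = 1`.  The `γ₁` is `T3ThresholdSmallness.exists_forall_θBal_le`'s for the target `min a₁ (ε₀/B₃)` (capped at `1`):
then at every height `n = ⌊K/m⌋`, `ε₁ = θBal(n)` satisfies (7)'s `ε₁ ≤ a₁` and `B₃ε₁ ≤ ε₀`; `m ≥ 2` gives `⌊K/m⌋ < K` for `K ≥ 1`.
[cite: Balaban1985Variational, Thm 1 p.279 and Prop 7 p.299] -/
theorem hasRegMinimisersPrAt_of_thm1GlobalMin {L : ℕ} (hT : Thm1GlobalMin L) :
    ∃ ε₁' : ℝ, 0 < ε₁' ∧ ∀ ε₀ : ℝ, 0 < ε₀ → ε₀ ≤ ε₁' → ∀ m : ℕ, 2 ≤ m → ∀ b₀ p₀ : ℝ, 0 < b₀ →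
      ∃ γ₁ : ℝ, 0 < γ₁ ∧ ∀ (F : T3Family) (γ : ℝ), F.L = L → 0 < γ → γ ≤ γ₁ → HasRegMinimisersPrAt F γ b₀ p₀ m ε₀ := by
  obtain ⟨a₀, a₁, B₃, ha₀, ha₁, hB₃, _, hT⟩ := hT
  refine ⟨a₀, ha₀, fun ε₀ hε₀ hε₀a m hm b₀ p₀ hb => ?_⟩
  by_cases hL : 1 ≤ L
  · -- thresholds below `σ := min a₁ (ε₀ / B₃)` at every height, for `γ ≤ γ₁`
    have hσ : 0 < min a₁ (ε₀ / B₃) := lt_min ha₁ (div_pos hε₀ hB₃)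
    obtain ⟨γ₁, hγ₁, hθ⟩ := exists_forall_θBal_le hL b₀ p₀ hσ
    refine ⟨min γ₁ 1, lt_min hγ₁ one_pos, fun F γ hF hγ hγle => ?_⟩
    have hγ₁' : γ ≤ γ₁ := hγle.trans (min_le_left _ _)
    have hγ1 : γ ≤ 1 := hγle.trans (min_le_right _ _)
    refine ⟨1, fun K hK V hV => ?_⟩
    -- the height `n = ⌊K/m⌋ < K ≤ K + 1`
    have hnK : K / m < K := Nat.div_lt_self (by omega) (by omega)
    have hnK' : K / m < K + 1 := hnK.trans (Nat.lt_succ_self K)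
    -- `ε₁ := θBal(n)`: positive, `≤ a₁`, `B₃ε₁ ≤ ε₀`
    have hFL : 1 ≤ F.L := F.hL.2.le
    have hε₁ : 0 < θBal F.L γ b₀ p₀ (K / m) := θBal_pos hFL hγ hγ1 hb p₀ (K / m)
    have hθle : θBal F.L γ b₀ p₀ (K / m) ≤ min a₁ (ε₀ / B₃) := by rw [hF]; exact hθ γ hγ hγ₁' (K / m)
    have hε₁a : θBal F.L γ b₀ p₀ (K / m) ≤ a₁ := hθle.trans (min_le_left _ _)
    have hlo : B₃ * θBal F.L γ b₀ p₀ (K / m) ≤ ε₀ := by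
      have h := mul_le_mul_of_nonneg_left (hθle.trans (min_le_right _ _)) hB₃.le
      rwa [mul_div_cancel₀ _ hB₃.ne'] at h
    exact ⟨exists_minimiser_of_thm1GlobalMinAt hT hF hnK hε₁ hε₁a hlo hε₀a hV,
      exists_minimiser_of_thm1GlobalMinAt hT hF hnK' hε₁ hε₁a hlo hε₀a hV⟩
  · -- no member of the family has block size `L < 1`
    refine ⟨1, one_pos, fun F γ hF _ _ => ?_⟩
    exact absurd (hF ▸ F.hL.2.le) hL

end Bridge

/-! ## §4 The decomposition: Thm 1's existence clause verbatim-shaped, and the located gap G-K1aR-2 as a schema -/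

section Decomposition

/-- **[Balaban1985Variational] THM 1, EXISTENCE CLAUSE (8), AT GIVEN CONSTANTS** (hypothesis schema, never asserted) — «for an arbitrary
configuration V satisfying (7) with ε₁ ≤ a₁ there exists a minimal orbit in the space 𝔘_k({Ω_j}, B₃ε₁) ∩ 𝔅_k(𝔅_k, V) (8)» in the
global-in-(8) reading (the LQB lane's `B10NestedMinimizer.B11Dict` (ii): the action of `U_k(V)` is ≤ the action of every configuration of
(8)), for the family's (0.4)-fibres, `n < K`. [cite: Balaban1985Variational, Thm 1 (8) p.279] -/
def Thm1MinimalIn8At (L : ℕ) (a₁ B₃ : ℝ) : Prop :=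
  ∀ F : T3Family, F.L = L → ∀ (n K : ℕ) (hnK : n < K) (ε₁ : ℝ), 0 < ε₁ → ε₁ ≤ a₁ →
    ∀ V : GaugeField (F.P n) 0 (Matrix.specialUnitaryGroup (Fin 2) ℂ), PlaqSmall ε₁ V →
      ∃ U ∈ regFibrePr F n K hnK.le (B₃ * ε₁) V,
        IsMinOn (fun W : GaugeField (F.P K) 0 (Matrix.specialUnitaryGroup (Fin 2) ℂ) => wilsonAction4 W)
          (regFibrePr F n K hnK.le (B₃ * ε₁) V) U

/-- **LOCATED GAP G-K1aR-2 AS A SCHEMA** (hypothesis, never asserted; NOT PRINTED as such): for `0 < ε₁ ≤ a₁` and `B₃ε₁ ≤ ε₀ ≤ a₀`, a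
minimiser of (5) over the small space (8) minimises (5) over the big space (6) — «inf over (6)(ε₀) = min over (8)(B₃ε₁)».  Print gives:
the minimiser is the unique critical orbit in (6) (Thm 1) and a LOCAL minimum (p. 299 l. 31–34); the global statement over (6) follows from
the expansion (142) with Sect. C's bounds on `V(A′)` over the whole chart (19)–(21), which print does not spell out (cell DIVERGENCE D-B11-2;
the hypothesis `hattain` of `B10NestedMinimizer.isMinOn_of_exists_min_of_unique_crit`). [cite: Balaban1985Variational, Prop 7 p.299] -/
def InfSixOfEightAt (L : ℕ) (a₀ a₁ B₃ : ℝ) : Prop :=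
  ∀ F : T3Family, F.L = L → ∀ (n K : ℕ) (hnK : n < K) (ε₁ ε₀ : ℝ), 0 < ε₁ → ε₁ ≤ a₁ → B₃ * ε₁ ≤ ε₀ → ε₀ ≤ a₀ →
    ∀ V : GaugeField (F.P n) 0 (Matrix.specialUnitaryGroup (Fin 2) ℂ), PlaqSmall ε₁ V →
      ∀ U ∈ regFibrePr F n K hnK.le (B₃ * ε₁) V,
        IsMinOn (fun W : GaugeField (F.P K) 0 (Matrix.specialUnitaryGroup (Fin 2) ℂ) => wilsonAction4 W)
            (regFibrePr F n K hnK.le (B₃ * ε₁) V) U →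
          IsMinOn (fun W : GaugeField (F.P K) 0 (Matrix.specialUnitaryGroup (Fin 2) ℂ) => wilsonAction4 W)
            (regFibrePr F n K hnK.le ε₀ V) U

/-- **BOOKKEEPING**: Thm 1's existence clause ∧ G-K1aR-2 ⇒ the global-reading schema of §2 (same constants). [cite: Balaban1985Variational, Thm 1 p.279 and Prop 7 p.299] -/
theorem thm1GlobalMinAt_of_minimalIn8 {L : ℕ} {a₀ a₁ B₃ : ℝ} (h8 : Thm1MinimalIn8At L a₁ B₃) (h68 : InfSixOfEightAt L a₀ a₁ B₃) :
    Thm1GlobalMinAt L a₀ a₁ B₃ :=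
  fun F hF n K hnK ε₁ ε₀ hε₁ hε₁a hlo hhi V hV => by
    obtain ⟨U, hU8, hmin8⟩ := h8 F hF n K hnK ε₁ hε₁ hε₁a V hV
    exact ⟨U, hU8, h68 F hF n K hnK ε₁ ε₀ hε₁ hε₁a hlo hhi V hV U hU8 hmin8⟩

/-- **BOOKKEEPING, converse direction**: the global-reading schema gives back Thm 1's existence clause (a minimiser over (6) lying in
(8) ⊆ (6) minimises over (8)), provided the window `[B₃ε₁, a₀]` is nonempty for `ε₁ ≤ a₁` (`B₃a₁ ≤ a₀`, as printed).
[cite: Balaban1985Variational, Thm 1 (8) p.279] -/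
theorem thm1MinimalIn8At_of_globalMin {L : ℕ} {a₀ a₁ B₃ : ℝ} (hB₃ : 0 ≤ B₃) (hwin : B₃ * a₁ ≤ a₀)
    (hT : Thm1GlobalMinAt L a₀ a₁ B₃) : Thm1MinimalIn8At L a₁ B₃ :=
  fun F hF n K hnK ε₁ hε₁ hε₁a V hV => by
    have hlo : B₃ * ε₁ ≤ B₃ * ε₁ := le_rfl
    have hhi : B₃ * ε₁ ≤ a₀ := (mul_le_mul_of_nonneg_left hε₁a hB₃).trans hwin
    obtain ⟨U, hU8, hmin⟩ := hT F hF n K hnK ε₁ (B₃ * ε₁) hε₁ hε₁a hlo hhi V hV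
    exact ⟨U, hU8, hmin⟩

/-- **THE EXIST STUB ⇐ THM 1'S EXISTENCE CLAUSE ∧ G-K1aR-2** (with the printed constants `a₀, a₁, B₃ > 0`), under the route's prefix —
the composition of §3 with the decomposition: what is taken from print verbatim, what is the one located statement, and what is proved.
[cite: Balaban1985Variational, Thm 1 p.279 and Prop 7 p.299] -/
theorem hasRegMinimisersPrAt_of_minimalIn8_of_infSixOfEight {L : ℕ} {a₀ a₁ B₃ : ℝ} (ha₀ : 0 < a₀) (ha₁ : 0 < a₁) (hB₃ : 0 < B₃)
    (hwin : B₃ * a₁ ≤ a₀) (h8 : Thm1MinimalIn8At L a₁ B₃) (h68 : InfSixOfEightAt L a₀ a₁ B₃) :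
    ∃ ε₁' : ℝ, 0 < ε₁' ∧ ∀ ε₀ : ℝ, 0 < ε₀ → ε₀ ≤ ε₁' → ∀ m : ℕ, 2 ≤ m → ∀ b₀ p₀ : ℝ, 0 < b₀ →
      ∃ γ₁ : ℝ, 0 < γ₁ ∧ ∀ (F : T3Family) (γ : ℝ), F.L = L → 0 < γ → γ ≤ γ₁ → HasRegMinimisersPrAt F γ b₀ p₀ m ε₀ :=
  hasRegMinimisersPrAt_of_thm1GlobalMin ⟨a₀, a₁, B₃, ha₀, ha₁, hB₃, hwin, thm1GlobalMinAt_of_minimalIn8 h8 h68⟩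

end Decomposition

end Literature.MathematicalPhysics.QuantumFieldTheory.Balaban1983to89.T3PrintedMinimiserExistence

end
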